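import Summits.BirchSwinnertonDyer.BirchSwinnertonDyer.Theorems.ResidualThetaTransportAtTwoSignedMuSeedAtTwoPlusPlusLocalMuRoadHabitat
import Summits.BirchSwinnertonDyer.BirchSwinnertonDyer.Theorems.ResidualThetaTransportAtTwoSignedMuSeedAtTwoPlusFlatDetectsOfMuPackage
import Summits.BirchSwinnertonDyer.BirchSwinnertonDyer.Theorems.ResidualThetaTransportAtTwoSignedMuSeedAtTwoPlusMuPackageTransport
import Literature.NumberTheory.EllipticCurves.Kobayashi2003.SignedSelmerDualExistsProofs
import HarnessLib

/-!
# Seed crux `SignedMuSeedAtTwoPlus` (stmt-BirchSwinnertonDyer-21438) / Kμ⁺ `SignedMuVanishingAtTwoPlus` (stmt-20689), line `kolyvagin_char_two`: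
# the seed and the crux BY NAME from {the `∀ I` μ-PACKAGE (= stubs S1 + S3 in one), stub S2 (Mazur–Rubin at the blind-spot prime `2Λ`),
# analytic supply S4, item 21437 ∣ Abbes–Ullmo} — the line's cone after this seat's μ-road, keyed to the route

Cell `bsd-wall`, width seat `bsd-wall-rtt-p4-w2` g8. THEOREMS ONLY (no `def`, no named fact, no `sorry`); `--supports` the crux; every research
input is a DISPLAYED hypothesis spelled VERBATIM as the registered stub texts of `Cruxes/SignedMuSeedAtTwoPlus/Lines/kolyvagin_char_two.lean`
(S2 `KatoBlindSpotBoundAtTwo`, S4 `AnalyticSupplyAtTwo`) or as this seat's μ-package; nothing about any curve is asserted; BSD is NOT proved by this.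

Composition (all pieces landed): (F) at every cyclotomic `κ'` from S2 + «a genuine class `s ∉ 2𝐇¹`», the latter from the `∀ I` μ-package
(`not_exists_eq_smul_of_not_C_dvd`, p647275: `2 ∤ col s`) at the canonical data (`Kato2004.nonempty_iwasawaH1Data_holds`,
`Kobayashi2003.signedSelmerDualData`) with analytic data from S4 and the FLAT scalar from 21437
(`signedMuAnalyticAtTwoPlus_iff_padicValRat_add_mu_eq_zero`); then `signedMuSeedAtTwoPlus_of_fine_of_muPackage` (p646071) through
`muPackage_exists_of_forall`. So the line `kolyvagin_char_two` reads, in the kernel: **seed ⟸ {μ-package, S2, S4, 21437}**, and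
**Kμ⁺ ⟸ {μ-package, S2, S4, Abbes–Ullmo}** — S1 and S3 are no longer separate stubs.

References: [MazurRubin2004] Thm. 5.3.10; [Kobayashi2003] (7.17)–(7.21), Thm. 6.3; [Kato2004Asterisque] Thm. 12.5, §13.1; [Greenberg1999LNM] Conj. 1.11;
[AbbesUllmo1996] Thm. A.
-/

set_option autoImplicit false
set_option linter.dupNamespace false

noncomputable section

open scoped Classical MatrixGroups ModularForm NumberField

open CongruenceSubgroup WeierstrassCurve Field IsDedekindDomain
  Literature.NumberTheory.GaloisRepresentations
  Literature.NumberTheory.EllipticCurves Literature.NumberTheory.EllipticCurves.ModularForms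
  Literature.NumberTheory.EllipticCurves.IwasawaAlgebra Literature.NumberTheory.EllipticCurves.Rank1Residual
  Literature.NumberTheory.EllipticCurves.Kobayashi2003 Literature.NumberTheory.EllipticCurves.Kato2004 ZpExtension
  Summit.BirchSwinnertonDyer.Rank1Residual.Supersingular Summit.BirchSwinnertonDyer.Rank1Residual.X1
  Summit.BirchSwinnertonDyer.BirchSwinnertonDyer.Theses.ResidualThetaTransportAtTwo

namespace Summit.BirchSwinnertonDyer.BirchSwinnertonDyer.Theorems.SignedMuAtTwo.PlusLocalMuRoad

/-- **(F) on the habitat⁺ from S2 + the `∀ I` μ-package** (+ analytic supply S4 and FLAT = 21437 to instantiate the package's analytic binders):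
at every cyclotomic `κ'` pick a topological generator, the canonical pinned data, get a genuine class `s` with `2 ∤ col s`, hence `s ∉ 2𝐇¹`, and
apply S2. This is `fineResidualFinite_of_flat` of the skeleton with S3 replaced by the package. [cite: MazurRubin2004, Thm. 5.3.10]
[cite: Kato2004Asterisque, Thm. 12.5 (p. 222) and §13.1 (p. 224)] -/
theorem fineResidualHabitat_of_blindSpot_of_muPackage
    (hPkg : ∀ (W : WeierstrassCurve ℚ) [W.IsElliptic] [W.IsGloballyMinimal], ¬ W.HasCM → W.analyticRank = 0 →
      GoodSS W 2 → W.frobeniusTrace 2 = 0 → W.Δ < 0 →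
      ∀ [NeZero (W.conductorNorm ℤ)] (f : CuspForm (Gamma0 (W.conductorNorm ℤ)) 2), IsNewformOf W f →
      ∀ (ϖ : ℚ), (ϖ : ℝ) * W.realPeriodRat = plusPeriod f →
      ∀ (Lplus Lminus : IwasawaAlgebra 2), IsPollackPair f 2 Lplus Lminus →
      padicValRat 2 ϖ + MuLambda.mu Lminus = 0 →
      ∀ [ContinuousSMul ℤ_[2] (W.tateModule 2)] [Module.Free ℤ_[2] (W.tateModule 2)]
        [Module.Finite ℤ_[2] (W.tateModule 2)]
        (κ : ZpExtension ℚ 2) (γ : Field.absoluteGaloisGroup ℚ) (hκ : κ.IsCyclotomic), κ.IsTopGenerator γ →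
      ∀ (I : Kato2004.IwasawaH1Data W 2 κ γ) (D : SignedSelmerDualData W κ γ 1),
      ∃ (Y : W.FineSelmerDualData κ γ) (P : Submodule (IwasawaAlgebra 2) (IwasawaAlgebra 2))
        (col : I.H →ₗ[IwasawaAlgebra 2] P) (j : P →ₗ[IwasawaAlgebra 2] D.X)
        (k : D.X →ₗ[IwasawaAlgebra 2] Y.X) (s : I.H),
        (∀ x : I.H, j (col x) = 0) ∧
        (∀ (x : D.X) (t : W.fineSelmerInfty κ),
          Y.toDual (k x) t = D.toDual x (AddSubgroup.inclusion (fineSelmerInfty_le_signedSelmerInfty W κ 1) t)) ∧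
        LinearMap.ker k ≤ LinearMap.range j ∧
        Kato2004.IsEulerSystemClassTwo W hκ I s ∧ ¬ PowerSeries.C (2 : ℤ_[2]) ∣ (P.subtype (col s)))
    (hS2 : ∀ (W : WeierstrassCurve ℚ) [W.IsElliptic] [W.IsGloballyMinimal], ¬ W.HasCM → W.analyticRank = 0 →
      GoodSS W 2 → W.frobeniusTrace 2 = 0 → W.Δ < 0 →
      ∀ [ContinuousSMul ℤ_[2] (W.tateModule 2)] [Module.Free ℤ_[2] (W.tateModule 2)]
        [Module.Finite ℤ_[2] (W.tateModule 2)]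
        (κ : ZpExtension ℚ 2) (γ : Field.absoluteGaloisGroup ℚ) (hκ : κ.IsCyclotomic), κ.IsTopGenerator γ →
      ∀ (I : Kato2004.IwasawaH1Data W 2 κ γ) (s : I.H), Kato2004.IsEulerSystemClassTwo W hκ I s →
        (¬ ∃ y : I.H, s = (2 : IwasawaAlgebra 2) • y) → Set.Finite {s : W.fineSelmerInfty κ | 2 • s = 0})
    (hS4 : ∀ (W : WeierstrassCurve ℚ) [W.IsElliptic] [W.IsGloballyMinimal], GoodSS W 2 → W.frobeniusTrace 2 = 0 →
      ∃ (_ : NeZero (W.conductorNorm ℤ)) (f : CuspForm (Gamma0 (W.conductorNorm ℤ)) 2) (ϖ : ℚ)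
        (Lplus Lminus : IwasawaAlgebra 2),
        IsNewformOf W f ∧ (ϖ : ℝ) * W.realPeriodRat = plusPeriod f ∧ IsPollackPair f 2 Lplus Lminus)
    (hFlat : SignedMuAnalyticAtTwoPlus) :
    ∀ (W : WeierstrassCurve ℚ) [W.IsElliptic] [W.IsGloballyMinimal], ¬ W.HasCM → W.analyticRank = 0 →
      GoodSS W 2 → W.frobeniusTrace 2 = 0 → W.Δ < 0 →
      ∀ (κ : ZpExtension ℚ 2), κ.IsCyclotomic → Set.Finite {s : W.fineSelmerInfty κ | 2 • s = 0} := by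
  intro W _ _ hCM hr hss ha hΔ κ hκ
  obtain ⟨hN, f, ϖ, Lplus, Lminus, hf, hϖ, hP⟩ := hS4 W hss ha
  have hflat : padicValRat 2 ϖ + MuLambda.mu Lminus = 0 :=
    (signedMuAnalyticAtTwoPlus_iff_padicValRat_add_mu_eq_zero.mp hFlat) W hCM hr hss ha hΔ f hf ϖ hϖ Lplus Lminus hP
  obtain ⟨γ, hγ⟩ : ∃ γ : Field.absoluteGaloisGroup ℚ, κ.IsTopGenerator γ := κ.surjective (Multiplicative.ofAdd 1)
  haveI : ContinuousSMul ℤ_[2] (W.tateModule 2) := TateModule.continuousSMul_padicInt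
  haveI : Module.Free ℤ_[2] (W.tateModule 2) := module_free_tateModule_holds W 2
  haveI : Module.Finite ℤ_[2] (W.tateModule 2) := module_finite_tateModule_holds W 2
  obtain ⟨I⟩ := Kato2004.nonempty_iwasawaH1Data_holds W 2 κ γ hκ hγ
  obtain ⟨Y, P, col, j, k, s, -, -, -, hES, hμ⟩ :=
    hPkg W hCM hr hss ha hΔ f hf ϖ hϖ Lplus Lminus hP hflat κ γ hκ hγ I (signedSelmerDualData W κ 1 hγ)
  have hndiv := not_exists_eq_smul_of_not_C_dvd P col s hμ
  rw [Nat.cast_ofNat] at hndiv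
  exact hS2 W hCM hr hss ha hΔ κ γ hκ hγ I s hES hndiv

/-- **Item 21438 `SignedMuSeedAtTwoPlus` BY NAME from {`∀ I` μ-package, S2, S4, 21437}** — line `kolyvagin_char_two` with S1 and S3 absorbed
into the package (`A := W`). [cite: MazurRubin2004, Thm. 5.3.10] [cite: Kobayashi2003, (7.17)–(7.21) and Thm. 6.3 (pp. 11–13)]
[cite: Greenberg1999LNM, Conj. 1.11] -/
theorem signedMuSeedAtTwoPlus_of_blindSpot_of_muPackage
    (hPkg : ∀ (W : WeierstrassCurve ℚ) [W.IsElliptic] [W.IsGloballyMinimal], ¬ W.HasCM → W.analyticRank = 0 →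
      GoodSS W 2 → W.frobeniusTrace 2 = 0 → W.Δ < 0 →
      ∀ [NeZero (W.conductorNorm ℤ)] (f : CuspForm (Gamma0 (W.conductorNorm ℤ)) 2), IsNewformOf W f →
      ∀ (ϖ : ℚ), (ϖ : ℝ) * W.realPeriodRat = plusPeriod f →
      ∀ (Lplus Lminus : IwasawaAlgebra 2), IsPollackPair f 2 Lplus Lminus →
      padicValRat 2 ϖ + MuLambda.mu Lminus = 0 →
      ∀ [ContinuousSMul ℤ_[2] (W.tateModule 2)] [Module.Free ℤ_[2] (W.tateModule 2)]
        [Module.Finite ℤ_[2] (W.tateModule 2)]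
        (κ : ZpExtension ℚ 2) (γ : Field.absoluteGaloisGroup ℚ) (hκ : κ.IsCyclotomic), κ.IsTopGenerator γ →
      ∀ (I : Kato2004.IwasawaH1Data W 2 κ γ) (D : SignedSelmerDualData W κ γ 1),
      ∃ (Y : W.FineSelmerDualData κ γ) (P : Submodule (IwasawaAlgebra 2) (IwasawaAlgebra 2))
        (col : I.H →ₗ[IwasawaAlgebra 2] P) (j : P →ₗ[IwasawaAlgebra 2] D.X)
        (k : D.X →ₗ[IwasawaAlgebra 2] Y.X) (s : I.H),
        (∀ x : I.H, j (col x) = 0) ∧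
        (∀ (x : D.X) (t : W.fineSelmerInfty κ),
          Y.toDual (k x) t = D.toDual x (AddSubgroup.inclusion (fineSelmerInfty_le_signedSelmerInfty W κ 1) t)) ∧
        LinearMap.ker k ≤ LinearMap.range j ∧
        Kato2004.IsEulerSystemClassTwo W hκ I s ∧ ¬ PowerSeries.C (2 : ℤ_[2]) ∣ (P.subtype (col s)))
    (hS2 : ∀ (W : WeierstrassCurve ℚ) [W.IsElliptic] [W.IsGloballyMinimal], ¬ W.HasCM → W.analyticRank = 0 →
      GoodSS W 2 → W.frobeniusTrace 2 = 0 → W.Δ < 0 →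
      ∀ [ContinuousSMul ℤ_[2] (W.tateModule 2)] [Module.Free ℤ_[2] (W.tateModule 2)]
        [Module.Finite ℤ_[2] (W.tateModule 2)]
        (κ : ZpExtension ℚ 2) (γ : Field.absoluteGaloisGroup ℚ) (hκ : κ.IsCyclotomic), κ.IsTopGenerator γ →
      ∀ (I : Kato2004.IwasawaH1Data W 2 κ γ) (s : I.H), Kato2004.IsEulerSystemClassTwo W hκ I s →
        (¬ ∃ y : I.H, s = (2 : IwasawaAlgebra 2) • y) → Set.Finite {s : W.fineSelmerInfty κ | 2 • s = 0})
    (hS4 : ∀ (W : WeierstrassCurve ℚ) [W.IsElliptic] [W.IsGloballyMinimal], GoodSS W 2 → W.frobeniusTrace 2 = 0 →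
      ∃ (_ : NeZero (W.conductorNorm ℤ)) (f : CuspForm (Gamma0 (W.conductorNorm ℤ)) 2) (ϖ : ℚ)
        (Lplus Lminus : IwasawaAlgebra 2),
        IsNewformOf W f ∧ (ϖ : ℝ) * W.realPeriodRat = plusPeriod f ∧ IsPollackPair f 2 Lplus Lminus)
    (hFlat : SignedMuAnalyticAtTwoPlus) :
    SignedMuSeedAtTwoPlus :=
  signedMuSeedAtTwoPlus_of_fine_of_muPackage (muPackage_exists_of_forall hPkg)
    (fineResidualHabitat_of_blindSpot_of_muPackage hPkg hS2 hS4 hFlat) hS4 hFlat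

/-- **The crux Kμ⁺ `SignedMuVanishingAtTwoPlus` BY NAME from {`∀ I` μ-package, S2, S4, 21437}.** BSD is not proved by this.
[cite: Greenberg1999LNM, Conj. 1.11] [cite: MazurRubin2004, Thm. 5.3.10] -/
theorem signedMuVanishingAtTwoPlus_of_blindSpot_of_muPackage
    (hPkg : ∀ (W : WeierstrassCurve ℚ) [W.IsElliptic] [W.IsGloballyMinimal], ¬ W.HasCM → W.analyticRank = 0 →
      GoodSS W 2 → W.frobeniusTrace 2 = 0 → W.Δ < 0 →
      ∀ [NeZero (W.conductorNorm ℤ)] (f : CuspForm (Gamma0 (W.conductorNorm ℤ)) 2), IsNewformOf W f →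
      ∀ (ϖ : ℚ), (ϖ : ℝ) * W.realPeriodRat = plusPeriod f →
      ∀ (Lplus Lminus : IwasawaAlgebra 2), IsPollackPair f 2 Lplus Lminus →
      padicValRat 2 ϖ + MuLambda.mu Lminus = 0 →
      ∀ [ContinuousSMul ℤ_[2] (W.tateModule 2)] [Module.Free ℤ_[2] (W.tateModule 2)]
        [Module.Finite ℤ_[2] (W.tateModule 2)]
        (κ : ZpExtension ℚ 2) (γ : Field.absoluteGaloisGroup ℚ) (hκ : κ.IsCyclotomic), κ.IsTopGenerator γ →
      ∀ (I : Kato2004.IwasawaH1Data W 2 κ γ) (D : SignedSelmerDualData W κ γ 1),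
      ∃ (Y : W.FineSelmerDualData κ γ) (P : Submodule (IwasawaAlgebra 2) (IwasawaAlgebra 2))
        (col : I.H →ₗ[IwasawaAlgebra 2] P) (j : P →ₗ[IwasawaAlgebra 2] D.X)
        (k : D.X →ₗ[IwasawaAlgebra 2] Y.X) (s : I.H),
        (∀ x : I.H, j (col x) = 0) ∧
        (∀ (x : D.X) (t : W.fineSelmerInfty κ),
          Y.toDual (k x) t = D.toDual x (AddSubgroup.inclusion (fineSelmerInfty_le_signedSelmerInfty W κ 1) t)) ∧
        LinearMap.ker k ≤ LinearMap.range j ∧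
        Kato2004.IsEulerSystemClassTwo W hκ I s ∧ ¬ PowerSeries.C (2 : ℤ_[2]) ∣ (P.subtype (col s)))
    (hS2 : ∀ (W : WeierstrassCurve ℚ) [W.IsElliptic] [W.IsGloballyMinimal], ¬ W.HasCM → W.analyticRank = 0 →
      GoodSS W 2 → W.frobeniusTrace 2 = 0 → W.Δ < 0 →
      ∀ [ContinuousSMul ℤ_[2] (W.tateModule 2)] [Module.Free ℤ_[2] (W.tateModule 2)]
        [Module.Finite ℤ_[2] (W.tateModule 2)]
        (κ : ZpExtension ℚ 2) (γ : Field.absoluteGaloisGroup ℚ) (hκ : κ.IsCyclotomic), κ.IsTopGenerator γ →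
      ∀ (I : Kato2004.IwasawaH1Data W 2 κ γ) (s : I.H), Kato2004.IsEulerSystemClassTwo W hκ I s →
        (¬ ∃ y : I.H, s = (2 : IwasawaAlgebra 2) • y) → Set.Finite {s : W.fineSelmerInfty κ | 2 • s = 0})
    (hS4 : ∀ (W : WeierstrassCurve ℚ) [W.IsElliptic] [W.IsGloballyMinimal], GoodSS W 2 → W.frobeniusTrace 2 = 0 →
      ∃ (_ : NeZero (W.conductorNorm ℤ)) (f : CuspForm (Gamma0 (W.conductorNorm ℤ)) 2) (ϖ : ℚ)
        (Lplus Lminus : IwasawaAlgebra 2),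
        IsNewformOf W f ∧ (ϖ : ℝ) * W.realPeriodRat = plusPeriod f ∧ IsPollackPair f 2 Lplus Lminus)
    (hFlat : SignedMuAnalyticAtTwoPlus) :
    SignedMuVanishingAtTwoPlus :=
  signedMuVanishingAtTwoPlus_of_analytic_of_seed hFlat (signedMuSeedAtTwoPlus_of_blindSpot_of_muPackage hPkg hS2 hS4 hFlat)

/-- **The crux Kμ⁺ BY NAME from {`∀ I` μ-package, S2, S4, Abbes–Ullmo Thm. A}** (21437 ⟸ Abbes–Ullmo, p643817). The complete cone of line
`kolyvagin_char_two` after the μ-road: one research PORT (the package), one research LEVER (S2), modularity (S4), one print fact. BSD is not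
proved by this. [cite: AbbesUllmo1996, Thm. A] [cite: MazurRubin2004, Thm. 5.3.10] [cite: Greenberg1999LNM, Conj. 1.11] -/
theorem signedMuVanishingAtTwoPlus_of_blindSpot_of_muPackage_of_abbesUllmo
    (hPkg : ∀ (W : WeierstrassCurve ℚ) [W.IsElliptic] [W.IsGloballyMinimal], ¬ W.HasCM → W.analyticRank = 0 →
      GoodSS W 2 → W.frobeniusTrace 2 = 0 → W.Δ < 0 →
      ∀ [NeZero (W.conductorNorm ℤ)] (f : CuspForm (Gamma0 (W.conductorNorm ℤ)) 2), IsNewformOf W f →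
      ∀ (ϖ : ℚ), (ϖ : ℝ) * W.realPeriodRat = plusPeriod f →
      ∀ (Lplus Lminus : IwasawaAlgebra 2), IsPollackPair f 2 Lplus Lminus →
      padicValRat 2 ϖ + MuLambda.mu Lminus = 0 →
      ∀ [ContinuousSMul ℤ_[2] (W.tateModule 2)] [Module.Free ℤ_[2] (W.tateModule 2)]
        [Module.Finite ℤ_[2] (W.tateModule 2)]
        (κ : ZpExtension ℚ 2) (γ : Field.absoluteGaloisGroup ℚ) (hκ : κ.IsCyclotomic), κ.IsTopGenerator γ →
      ∀ (I : Kato2004.IwasawaH1Data W 2 κ γ) (D : SignedSelmerDualData W κ γ 1),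
      ∃ (Y : W.FineSelmerDualData κ γ) (P : Submodule (IwasawaAlgebra 2) (IwasawaAlgebra 2))
        (col : I.H →ₗ[IwasawaAlgebra 2] P) (j : P →ₗ[IwasawaAlgebra 2] D.X)
        (k : D.X →ₗ[IwasawaAlgebra 2] Y.X) (s : I.H),
        (∀ x : I.H, j (col x) = 0) ∧
        (∀ (x : D.X) (t : W.fineSelmerInfty κ),
          Y.toDual (k x) t = D.toDual x (AddSubgroup.inclusion (fineSelmerInfty_le_signedSelmerInfty W κ 1) t)) ∧
        LinearMap.ker k ≤ LinearMap.range j ∧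
        Kato2004.IsEulerSystemClassTwo W hκ I s ∧ ¬ PowerSeries.C (2 : ℤ_[2]) ∣ (P.subtype (col s)))
    (hS2 : ∀ (W : WeierstrassCurve ℚ) [W.IsElliptic] [W.IsGloballyMinimal], ¬ W.HasCM → W.analyticRank = 0 →
      GoodSS W 2 → W.frobeniusTrace 2 = 0 → W.Δ < 0 →
      ∀ [ContinuousSMul ℤ_[2] (W.tateModule 2)] [Module.Free ℤ_[2] (W.tateModule 2)]
        [Module.Finite ℤ_[2] (W.tateModule 2)]
        (κ : ZpExtension ℚ 2) (γ : Field.absoluteGaloisGroup ℚ) (hκ : κ.IsCyclotomic), κ.IsTopGenerator γ →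
      ∀ (I : Kato2004.IwasawaH1Data W 2 κ γ) (s : I.H), Kato2004.IsEulerSystemClassTwo W hκ I s →
        (¬ ∃ y : I.H, s = (2 : IwasawaAlgebra 2) • y) → Set.Finite {s : W.fineSelmerInfty κ | 2 • s = 0})
    (hS4 : ∀ (W : WeierstrassCurve ℚ) [W.IsElliptic] [W.IsGloballyMinimal], GoodSS W 2 → W.frobeniusTrace 2 = 0 →
      ∃ (_ : NeZero (W.conductorNorm ℤ)) (f : CuspForm (Gamma0 (W.conductorNorm ℤ)) 2) (ϖ : ℚ)
        (Lplus Lminus : IwasawaAlgebra 2),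
        IsNewformOf W f ∧ (ϖ : ℝ) * W.realPeriodRat = plusPeriod f ∧ IsPollackPair f 2 Lplus Lminus)
    (hAU : abbesUllmo_not_dvd_maninConstant_of_not_dvd_level) :
    SignedMuVanishingAtTwoPlus :=
  signedMuVanishingAtTwoPlus_of_blindSpot_of_muPackage hPkg hS2 hS4 (signedMuAnalyticAtTwoPlus_of_abbesUllmo' hAU)

/-! ## Appended (same seat): the same three certificates from the `∃ I` package — ONE package text for S1, S3 and the seed
(`muPackage_forall_of_exists`, file `…MuPackageTransport`: the package transports along Kato's uniqueness of the pin `𝐇¹_Γ(T₂W)`) -/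

/-- **Item 21438 BY NAME from {`∃ I` μ-package (= the hypothesis of `flatPlusLocalHalfAtTwo_of_muPackage` / `signedMuSeedAtTwoPlus_of_fine_of_muPackage`),
S2, S4, 21437}.** [cite: MazurRubin2004, Thm. 5.3.10] [cite: Kato2004Asterisque, §12.2 (p. 220) and Thm. 12.5 (p. 222)] [cite: Greenberg1999LNM, Conj. 1.11] -/
theorem signedMuSeedAtTwoPlus_of_blindSpot_of_muPackage_exists
    (hPkg : ∀ (W : WeierstrassCurve ℚ) [W.IsElliptic] [W.IsGloballyMinimal], ¬ W.HasCM → W.analyticRank = 0 →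
      GoodSS W 2 → W.frobeniusTrace 2 = 0 → W.Δ < 0 →
      ∀ [NeZero (W.conductorNorm ℤ)] (f : CuspForm (Gamma0 (W.conductorNorm ℤ)) 2), IsNewformOf W f →
      ∀ (ϖ : ℚ), (ϖ : ℝ) * W.realPeriodRat = plusPeriod f →
      ∀ (Lplus Lminus : IwasawaAlgebra 2), IsPollackPair f 2 Lplus Lminus →
      padicValRat 2 ϖ + MuLambda.mu Lminus = 0 →
      ∀ [ContinuousSMul ℤ_[2] (W.tateModule 2)] [Module.Free ℤ_[2] (W.tateModule 2)]
        [Module.Finite ℤ_[2] (W.tateModule 2)]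
        (κ : ZpExtension ℚ 2) (γ : Field.absoluteGaloisGroup ℚ) (hκ : κ.IsCyclotomic), κ.IsTopGenerator γ →
      ∀ (D : SignedSelmerDualData W κ γ 1),
      ∃ (I : Kato2004.IwasawaH1Data W 2 κ γ) (Y : W.FineSelmerDualData κ γ)
        (P : Submodule (IwasawaAlgebra 2) (IwasawaAlgebra 2))
        (col : I.H →ₗ[IwasawaAlgebra 2] P) (j : P →ₗ[IwasawaAlgebra 2] D.X)
        (k : D.X →ₗ[IwasawaAlgebra 2] Y.X) (s : I.H),
        (∀ x : I.H, j (col x) = 0) ∧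
        (∀ (x : D.X) (t : W.fineSelmerInfty κ),
          Y.toDual (k x) t = D.toDual x (AddSubgroup.inclusion (fineSelmerInfty_le_signedSelmerInfty W κ 1) t)) ∧
        LinearMap.ker k ≤ LinearMap.range j ∧
        Kato2004.IsEulerSystemClassTwo W hκ I s ∧ ¬ PowerSeries.C (2 : ℤ_[2]) ∣ (P.subtype (col s)))
    (hS2 : ∀ (W : WeierstrassCurve ℚ) [W.IsElliptic] [W.IsGloballyMinimal], ¬ W.HasCM → W.analyticRank = 0 →
      GoodSS W 2 → W.frobeniusTrace 2 = 0 → W.Δ < 0 →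
      ∀ [ContinuousSMul ℤ_[2] (W.tateModule 2)] [Module.Free ℤ_[2] (W.tateModule 2)]
        [Module.Finite ℤ_[2] (W.tateModule 2)]
        (κ : ZpExtension ℚ 2) (γ : Field.absoluteGaloisGroup ℚ) (hκ : κ.IsCyclotomic), κ.IsTopGenerator γ →
      ∀ (I : Kato2004.IwasawaH1Data W 2 κ γ) (s : I.H), Kato2004.IsEulerSystemClassTwo W hκ I s →
        (¬ ∃ y : I.H, s = (2 : IwasawaAlgebra 2) • y) → Set.Finite {s : W.fineSelmerInfty κ | 2 • s = 0})
    (hS4 : ∀ (W : WeierstrassCurve ℚ) [W.IsElliptic] [W.IsGloballyMinimal], GoodSS W 2 → W.frobeniusTrace 2 = 0 →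
      ∃ (_ : NeZero (W.conductorNorm ℤ)) (f : CuspForm (Gamma0 (W.conductorNorm ℤ)) 2) (ϖ : ℚ)
        (Lplus Lminus : IwasawaAlgebra 2),
        IsNewformOf W f ∧ (ϖ : ℝ) * W.realPeriodRat = plusPeriod f ∧ IsPollackPair f 2 Lplus Lminus)
    (hFlat : SignedMuAnalyticAtTwoPlus) :
    SignedMuSeedAtTwoPlus :=
  signedMuSeedAtTwoPlus_of_blindSpot_of_muPackage (muPackage_forall_of_exists hPkg) hS2 hS4 hFlat

/-- **The crux Kμ⁺ BY NAME from {`∃ I` μ-package, S2, S4, 21437}.** BSD is not proved by this. [cite: Greenberg1999LNM, Conj. 1.11]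
[cite: MazurRubin2004, Thm. 5.3.10] -/
theorem signedMuVanishingAtTwoPlus_of_blindSpot_of_muPackage_exists
    (hPkg : ∀ (W : WeierstrassCurve ℚ) [W.IsElliptic] [W.IsGloballyMinimal], ¬ W.HasCM → W.analyticRank = 0 →
      GoodSS W 2 → W.frobeniusTrace 2 = 0 → W.Δ < 0 →
      ∀ [NeZero (W.conductorNorm ℤ)] (f : CuspForm (Gamma0 (W.conductorNorm ℤ)) 2), IsNewformOf W f →
      ∀ (ϖ : ℚ), (ϖ : ℝ) * W.realPeriodRat = plusPeriod f →
      ∀ (Lplus Lminus : IwasawaAlgebra 2), IsPollackPair f 2 Lplus Lminus →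
      padicValRat 2 ϖ + MuLambda.mu Lminus = 0 →
      ∀ [ContinuousSMul ℤ_[2] (W.tateModule 2)] [Module.Free ℤ_[2] (W.tateModule 2)]
        [Module.Finite ℤ_[2] (W.tateModule 2)]
        (κ : ZpExtension ℚ 2) (γ : Field.absoluteGaloisGroup ℚ) (hκ : κ.IsCyclotomic), κ.IsTopGenerator γ →
      ∀ (D : SignedSelmerDualData W κ γ 1),
      ∃ (I : Kato2004.IwasawaH1Data W 2 κ γ) (Y : W.FineSelmerDualData κ γ)
        (P : Submodule (IwasawaAlgebra 2) (IwasawaAlgebra 2))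
        (col : I.H →ₗ[IwasawaAlgebra 2] P) (j : P →ₗ[IwasawaAlgebra 2] D.X)
        (k : D.X →ₗ[IwasawaAlgebra 2] Y.X) (s : I.H),
        (∀ x : I.H, j (col x) = 0) ∧
        (∀ (x : D.X) (t : W.fineSelmerInfty κ),
          Y.toDual (k x) t = D.toDual x (AddSubgroup.inclusion (fineSelmerInfty_le_signedSelmerInfty W κ 1) t)) ∧
        LinearMap.ker k ≤ LinearMap.range j ∧
        Kato2004.IsEulerSystemClassTwo W hκ I s ∧ ¬ PowerSeries.C (2 : ℤ_[2]) ∣ (P.subtype (col s)))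
    (hS2 : ∀ (W : WeierstrassCurve ℚ) [W.IsElliptic] [W.IsGloballyMinimal], ¬ W.HasCM → W.analyticRank = 0 →
      GoodSS W 2 → W.frobeniusTrace 2 = 0 → W.Δ < 0 →
      ∀ [ContinuousSMul ℤ_[2] (W.tateModule 2)] [Module.Free ℤ_[2] (W.tateModule 2)]
        [Module.Finite ℤ_[2] (W.tateModule 2)]
        (κ : ZpExtension ℚ 2) (γ : Field.absoluteGaloisGroup ℚ) (hκ : κ.IsCyclotomic), κ.IsTopGenerator γ →
      ∀ (I : Kato2004.IwasawaH1Data W 2 κ γ) (s : I.H), Kato2004.IsEulerSystemClassTwo W hκ I s →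
        (¬ ∃ y : I.H, s = (2 : IwasawaAlgebra 2) • y) → Set.Finite {s : W.fineSelmerInfty κ | 2 • s = 0})
    (hS4 : ∀ (W : WeierstrassCurve ℚ) [W.IsElliptic] [W.IsGloballyMinimal], GoodSS W 2 → W.frobeniusTrace 2 = 0 →
      ∃ (_ : NeZero (W.conductorNorm ℤ)) (f : CuspForm (Gamma0 (W.conductorNorm ℤ)) 2) (ϖ : ℚ)
        (Lplus Lminus : IwasawaAlgebra 2),
        IsNewformOf W f ∧ (ϖ : ℝ) * W.realPeriodRat = plusPeriod f ∧ IsPollackPair f 2 Lplus Lminus)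
    (hFlat : SignedMuAnalyticAtTwoPlus) :
    SignedMuVanishingAtTwoPlus :=
  signedMuVanishingAtTwoPlus_of_blindSpot_of_muPackage (muPackage_forall_of_exists hPkg) hS2 hS4 hFlat

/-- **The crux Kμ⁺ BY NAME from {`∃ I` μ-package, S2, S4, Abbes–Ullmo Thm. A}** — the FINAL cone of line `kolyvagin_char_two` after the
μ-road: ONE research port (the package = content of S1 ∪ S3), ONE research lever (S2), modularity (S4), one print fact. BSD is not proved by this.
[cite: AbbesUllmo1996, Thm. A] [cite: MazurRubin2004, Thm. 5.3.10] [cite: Greenberg1999LNM, Conj. 1.11] -/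
theorem signedMuVanishingAtTwoPlus_of_blindSpot_of_muPackage_exists_of_abbesUllmo
    (hPkg : ∀ (W : WeierstrassCurve ℚ) [W.IsElliptic] [W.IsGloballyMinimal], ¬ W.HasCM → W.analyticRank = 0 →
      GoodSS W 2 → W.frobeniusTrace 2 = 0 → W.Δ < 0 →
      ∀ [NeZero (W.conductorNorm ℤ)] (f : CuspForm (Gamma0 (W.conductorNorm ℤ)) 2), IsNewformOf W f →
      ∀ (ϖ : ℚ), (ϖ : ℝ) * W.realPeriodRat = plusPeriod f →
      ∀ (Lplus Lminus : IwasawaAlgebra 2), IsPollackPair f 2 Lplus Lminus →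
      padicValRat 2 ϖ + MuLambda.mu Lminus = 0 →
      ∀ [ContinuousSMul ℤ_[2] (W.tateModule 2)] [Module.Free ℤ_[2] (W.tateModule 2)]
        [Module.Finite ℤ_[2] (W.tateModule 2)]
        (κ : ZpExtension ℚ 2) (γ : Field.absoluteGaloisGroup ℚ) (hκ : κ.IsCyclotomic), κ.IsTopGenerator γ →
      ∀ (D : SignedSelmerDualData W κ γ 1),
      ∃ (I : Kato2004.IwasawaH1Data W 2 κ γ) (Y : W.FineSelmerDualData κ γ)
        (P : Submodule (IwasawaAlgebra 2) (IwasawaAlgebra 2))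
        (col : I.H →ₗ[IwasawaAlgebra 2] P) (j : P →ₗ[IwasawaAlgebra 2] D.X)
        (k : D.X →ₗ[IwasawaAlgebra 2] Y.X) (s : I.H),
        (∀ x : I.H, j (col x) = 0) ∧
        (∀ (x : D.X) (t : W.fineSelmerInfty κ),
          Y.toDual (k x) t = D.toDual x (AddSubgroup.inclusion (fineSelmerInfty_le_signedSelmerInfty W κ 1) t)) ∧
        LinearMap.ker k ≤ LinearMap.range j ∧
        Kato2004.IsEulerSystemClassTwo W hκ I s ∧ ¬ PowerSeries.C (2 : ℤ_[2]) ∣ (P.subtype (col s)))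
    (hS2 : ∀ (W : WeierstrassCurve ℚ) [W.IsElliptic] [W.IsGloballyMinimal], ¬ W.HasCM → W.analyticRank = 0 →
      GoodSS W 2 → W.frobeniusTrace 2 = 0 → W.Δ < 0 →
      ∀ [ContinuousSMul ℤ_[2] (W.tateModule 2)] [Module.Free ℤ_[2] (W.tateModule 2)]
        [Module.Finite ℤ_[2] (W.tateModule 2)]
        (κ : ZpExtension ℚ 2) (γ : Field.absoluteGaloisGroup ℚ) (hκ : κ.IsCyclotomic), κ.IsTopGenerator γ →
      ∀ (I : Kato2004.IwasawaH1Data W 2 κ γ) (s : I.H), Kato2004.IsEulerSystemClassTwo W hκ I s →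
        (¬ ∃ y : I.H, s = (2 : IwasawaAlgebra 2) • y) → Set.Finite {s : W.fineSelmerInfty κ | 2 • s = 0})
    (hS4 : ∀ (W : WeierstrassCurve ℚ) [W.IsElliptic] [W.IsGloballyMinimal], GoodSS W 2 → W.frobeniusTrace 2 = 0 →
      ∃ (_ : NeZero (W.conductorNorm ℤ)) (f : CuspForm (Gamma0 (W.conductorNorm ℤ)) 2) (ϖ : ℚ)
        (Lplus Lminus : IwasawaAlgebra 2),
        IsNewformOf W f ∧ (ϖ : ℝ) * W.realPeriodRat = plusPeriod f ∧ IsPollackPair f 2 Lplus Lminus)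
    (hAU : abbesUllmo_not_dvd_maninConstant_of_not_dvd_level) :
    SignedMuVanishingAtTwoPlus :=
  signedMuVanishingAtTwoPlus_of_blindSpot_of_muPackage (muPackage_forall_of_exists hPkg) hS2 hS4
    (signedMuAnalyticAtTwoPlus_of_abbesUllmo' hAU)

end Summit.BirchSwinnertonDyer.BirchSwinnertonDyer.Theorems.SignedMuAtTwo.PlusLocalMuRoad

end
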